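import Summits.BirchSwinnertonDyer.Rank1Residual.SmallImageMu.KatzLineMuTransfer
import Summits.BirchSwinnertonDyer.Rank1Residual.SmallImageMu.KatoDivisibility
import Summits.BirchSwinnertonDyer.BirchSwinnertonDyer.Theorems.Rank1ResidualX9MuTransfer
import Literature.NumberTheory.EllipticCurves.Rank1Residual.MuLeFineMuCarrier
import Literature.NumberTheory.EllipticCurves.Rank1Residual.X9MuInvariant
import HarnessLib
import HarnessLib.Audit

/-!
# Kernel glue of desc-C8: the Katz-line transfer delivers the crux `KatoDivisibilityOnClassX9` AT EVERY
# CERTIFIED PAIR; the full statement contains its non-anomalous restriction; cover engines — theorems only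

HONEST FRAMING (cell `bsd-f3-mu`).  THEOREMS ONLY, sorry-free; CONDITIONAL, credits nothing.  Granted the
candidate `KatzLineMuTransferX9` (`hU`) and BCS 2025 Thm. 1.1.2 (a) (`hBCS`), an X9 pair with the Katz-line
certificate satisfies Kato's integral divisibility `KatoDivisibilityAt W p` (through `μ(X) = 0`,
`Rank1Residual.MuAlgZeroAt.katoDivisibilityAt`); the class-wide COVER ENGINES take as DATA «Katz-line certified,
or the conclusion otherwise» (`hcover`).  Ported from `HOME/desc/Sketch8.lean` §3 (sha16 64fbba5768810d9b, rc 0).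

References: [EmertonPollackWeston2006] Thm. 3.3.2; [HaraOchiai2018]; [Rubin1991] Thm. 4.1 (i);
[BurungaleCastellaSkinner2025] Thm. 1.1.2 (a); [GreenbergLNM1716] §1 Conj. 1.11; HOME MEMO-desc.md §14.
-/

-- the summit and its single problem are both named `BirchSwinnertonDyer` (registry layout D-0017)
set_option linter.dupNamespace false

noncomputable section

open scoped Classical MatrixGroups ModularForm

open CongruenceSubgroup WeierstrassCurve Literature.NumberTheory.EllipticCurves
  Literature.NumberTheory.EllipticCurves.ModularForms
  Literature.NumberTheory.EllipticCurves.BurungaleCastellaSkinner2025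
  Summit.BirchSwinnertonDyer.BirchSwinnertonDyer.Rank1Residual
open Literature.NumberTheory.EllipticCurves.Rank1Residual (KatzLineCertAt KatoDivisibilityAt MuAlgZeroAt
  mazurMainConjecture_of_mu_eq_zero)

namespace Summit.BirchSwinnertonDyer.Rank1Residual.SmallImageMu

/-- The full statement implies its non-anomalous restriction. [cite: HaraOchiai2018, hypothesis (ntr)] -/
theorem katzLineMuTransferX9NonAnomalous_of (hU : KatzLineMuTransferX9) :
    KatzLineMuTransferX9NonAnomalous :=
  fun W _ _ p _ hX9 _ hc => hU W p hX9 hc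

section PerPair

variable {W : WeierstrassCurve ℚ} [W.IsElliptic] [W.IsGloballyMinimal] {p : ℕ} [Fact p.Prime]

/-- **U1″ ⟹ the crux `KatoDivisibilityOnClassX9` AT EVERY CERTIFIED PAIR** (BCS (a) edge through `μ(X) = 0`).
[cite: EmertonPollackWeston2006, Thm. 3.3.2] [cite: BurungaleCastellaSkinner2025, Thm. 1.1.2 (a)] -/
theorem katoDivisibilityAt_of_katzLineCertAt (hU : KatzLineMuTransferX9)
    (hBCS : burungale_castella_skinner_charIdeal_eq_padicLFunction)
    (hX9 : ClassX9 W p) (hc : KatzLineCertAt W p) : KatoDivisibilityAt W p := by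
  obtain ⟨-, hp, hgood, hord, hirr, -⟩ := id hX9
  exact (hU W p hX9 hc).katoDivisibilityAt hBCS hp hgood hord hirr

end PerPair

/-- **desc-C8 reduces the node `KatoDivisibilityOnClassX9` to the X9 pairs without a Katz-line certificate**
(+ BCS (a)): `hcover` = Katz-line certified, or Kato divisibility at the pair otherwise.
[cite: EmertonPollackWeston2006, Thm. 3.3.2] [cite: BurungaleCastellaSkinner2025, Thm. 1.1.2 (a)] -/
theorem katoDivisibilityOnClassX9_of_katzLineMuTransfer_of_cover (hU : KatzLineMuTransferX9)
    (hBCS : burungale_castella_skinner_charIdeal_eq_padicLFunction)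
    (hcover : ∀ (W : WeierstrassCurve ℚ) [W.IsElliptic] [W.IsGloballyMinimal] (p : ℕ) [Fact p.Prime],
      ClassX9 W p → KatzLineCertAt W p ∨ KatoDivisibilityAt W p) :
    KatoDivisibilityOnClassX9 := by
  intro W _ _ p _ κ γ N _ f hX9 hκ hγ hγ' hf D
  have hK : KatoDivisibilityAt W p := by
    rcases hcover W p hX9 with hc | hK
    · exact katoDivisibilityAt_of_katzLineCertAt hU hBCS hX9 hc
    · exact hK
  exact hK κ γ f hκ hγ hγ' hf D

/-- **desc-C8 with the analytic certificate reduces the INTEGRAL main conjecture on X9 to the uncertified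
pairs**: `hcover` = Katz-line certified, or `μ(X(E/ℚ_∞)) = 0` there otherwise; with `AnalyticMuZeroOnClassX9`
(`hA`) the node `IntegralMainConjectureOnClassX9` follows (`Rank1Residual.mazurMainConjecture_of_mu_eq_zero`).
[cite: EmertonPollackWeston2006, Thm. 3.3.2] [cite: GreenbergLNM1716, §1 Conj. 1.11] [cite: BurungaleCastellaSkinner2025, Thm. 1.1.2 (a)] -/
theorem integralMainConjectureOnClassX9_of_katzLineMuTransfer_of_cover (hU : KatzLineMuTransferX9)
    (hBCS : burungale_castella_skinner_charIdeal_eq_padicLFunction) (hA : AnalyticMuZeroOnClassX9)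
    (hcover : ∀ (W : WeierstrassCurve ℚ) [W.IsElliptic] [W.IsGloballyMinimal] (p : ℕ) [Fact p.Prime],
      ClassX9 W p → KatzLineCertAt W p ∨ MuAlgZeroAt W p) :
    IntegralMainConjectureOnClassX9 := by
  intro W _ _ p _ κ γ N _ f hX9 hκ hγ hγ' hf D
  obtain ⟨-, hp, hgood, hord, hirr, -⟩ := id hX9
  have hμalg : MuAlgZeroAt W p := by
    rcases hcover W p hX9 with hc | h
    · exact hU W p hX9 hc
    · exact h
  exact mazurMainConjecture_of_mu_eq_zero hBCS W p hp hgood hord hirr κ γ hκ hγ hγ' f hf D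
    (hμalg κ γ hκ hγ hγ' D) (hA W p f hX9 hf)

end Summit.BirchSwinnertonDyer.Rank1Residual.SmallImageMu

end
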